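import Summits.MatrixMultiplication.OmegaCensus.BoxRatioSectionLaw
import Mathlib.GroupTheory.Complement
import Mathlib.Data.Set.Card

/-!
# ω-census, family (b3): conjecture C9 (a) in the kernel — box-usefulness passes to subgroups and quotients

HONEST FRAMING (pub-omega census; verbatim): lottery ticket; floor = certified bounds/negative ranges.  Census BOOKKEEPING for
the typed conjecture C9 (`BoxRatioSectionLaw.lean`, STRUCTURE.md §2): its PROVED half (a) 'the box ratio α(G;|G|,3,3)/|G| is
monotone under sections', stated in the vocabulary of `BoxUseful` (α < (9/5)|G|) for SUBGROUPS and QUOTIENTS; so the class of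
box-useful finite groups is closed under sections, which is why C9 (b) lists section-closed classes.  Nothing here is
progress on `ω`.

**Theorem (`BoxUseful.subgroup`).** If `G` is box-useful then so is every subgroup `H ≤ G`.  *Proof (right-transversal lift,
the box form of `realizesTPP_index_mul_of_subgroup`):* with `R` a right transversal of `H`, an independent set `I` of `H`-cells
in `H × Y × W` lifts to the `[G:H]·|I|` distinct `G`-cells `(h r, y, w)`, which are independent — a trivial word
`(h r)(h' r')⁻¹ (y y'⁻¹)(w w'⁻¹)` forces `r r'⁻¹ ∈ H`, so `r = r'`, and then it is the word of the two `H`-cells; hence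
`5·[G:H]·|I| < 9·|G| = 9·[G:H]·|H|`. ∎
**Theorem (`BoxUseful.quotient`).** If `G` is box-useful then so is `G ⧸ N` for every normal `N`.  *Proof (the box form of
Cohn–Umans Lemma 2.2):* along a section `σ` of `G → G/N`, an independent set `I` of `G/N`-cells lifts to the `|N|·|I|` cells
`(σ(q) n, σ(ȳ), σ(w̄))`, `n ∈ N`; a trivial word projects to the trivial word of the two `G/N`-cells, so either they are
distinct members of `I` (excluded) or equal, and then the word is `σ(q) n n'⁻¹ σ(q)⁻¹ ≠ 1`; hence `5·|N|·|I| < 9·|G|`. ∎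
-/

namespace Summit.MatrixMultiplication.OmegaCensus

open Finset ProductBoxBound

variable {G : Type*} [Group G] [Fintype G] [DecidableEq G]

omit [Fintype G] [DecidableEq G] in
/-- The cell word commutes with the inclusion of a subgroup (componentwise). [folklore] -/
theorem cellWord_subtype (H : Subgroup G) (c c' : ↥H × ↥H × ↥H) :
    ((cellWord c c' : ↥H) : G) = cellWord ((c.1 : G), ((c.2.1 : G), (c.2.2 : G))) ((c'.1 : G), ((c'.2.1 : G), (c'.2.2 : G))) := by
  simp [cellWord]

/-- **C9 (a), subgroup half, in the kernel.** Box-usefulness passes from a finite group to each of its subgroups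
(right-transversal lift of independent cell sets). [folklore] -/
theorem BoxUseful.subgroup (hG : BoxUseful G) (H : Subgroup G) [Fintype ↥H] : BoxUseful ↥H := by
  classical
  intro Y W hY hW I hI hind
  obtain ⟨R, hR, -⟩ := H.exists_isComplement_right 1
  have hRfin : R.Finite := Set.toFinite R
  have memRf : ∀ r, r ∈ hRfin.toFinset ↔ r ∈ R := fun r => Set.Finite.mem_toFinset hRfin
  have cardRf : hRfin.toFinset.card = H.index := by
    rw [← hR.ncard_right, Set.ncard_eq_toFinset_card R hRfin]
  have uniq : ∀ (h₁ h₂ : G) (r₁ r₂ : G), h₁ ∈ H → h₂ ∈ H → r₁ ∈ R → r₂ ∈ R →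
      h₁ * r₁ = h₂ * r₂ → h₁ = h₂ ∧ r₁ = r₂ := by
    intro h₁ h₂ r₁ r₂ hh₁ hh₂ hr₁ hr₂ heq
    have := @hR.1 (⟨h₁, hh₁⟩, ⟨r₁, hr₁⟩) (⟨h₂, hh₂⟩, ⟨r₂, hr₂⟩) (by simpa using heq)
    simp only [Prod.mk.injEq, Subtype.mk.injEq] at this
    exact this
  -- the lift of cells
  let lift : (↥H × ↥H × ↥H) × G → G × G × G := fun p => ((p.1.1 : G) * p.2, ((p.1.2.1 : G), (p.1.2.2 : G)))
  have lift_inj : Set.InjOn lift ↑(I ×ˢ hRfin.toFinset) := by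
    rintro ⟨c, r⟩ hcr ⟨c', r'⟩ hcr' heq
    simp only [Finset.coe_product, Set.mem_prod, Finset.mem_coe, memRf] at hcr hcr'
    simp only [lift, Prod.mk.injEq] at heq
    obtain ⟨h1, h23⟩ := heq
    obtain ⟨hx, hr⟩ := uniq _ _ _ _ c.1.2 c'.1.2 hcr.2 hcr'.2 h1
    have hc : c = c' := Prod.ext (Subtype.ext hx) (Prod.ext (Subtype.ext h23.1) (Subtype.ext h23.2))
    exact Prod.ext hc hr
  let emb : ↥H ↪ G := ⟨Subtype.val, Subtype.val_injective⟩
  set J : Finset (G × G × G) := (I ×ˢ hRfin.toFinset).image lift with hJ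
  have hJcard : J.card = I.card * H.index := by
    rw [hJ, Finset.card_image_of_injOn lift_inj, Finset.card_product, cardRf]
  have hJbox : J ⊆ univ ×ˢ (Y.map emb ×ˢ W.map emb) := by
    intro P hP
    obtain ⟨⟨c, r⟩, hcr, rfl⟩ := Finset.mem_image.1 hP
    rw [Finset.mem_product] at hcr
    have hc := hI hcr.1
    simp only [Finset.mem_product, Finset.mem_univ, true_and] at hc
    simp only [lift, Finset.mem_product, Finset.mem_univ, true_and, Finset.mem_map, Function.Embedding.coeFn_mk, emb]
    exact ⟨⟨c.2.1, hc.1, rfl⟩, ⟨c.2.2, hc.2, rfl⟩⟩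
  have hJind : ∀ P ∈ J, ∀ P' ∈ J, P ≠ P' → cellWord P P' ≠ 1 := by
    intro P hP P' hP' hne hw
    obtain ⟨⟨c, r⟩, hcr, rfl⟩ := Finset.mem_image.1 hP
    obtain ⟨⟨c', r'⟩, hcr', rfl⟩ := Finset.mem_image.1 hP'
    simp only [Finset.mem_product, memRf] at hcr hcr'
    -- the hidden `H`-word
    set k : ↥H := c.2.1 * c'.2.1⁻¹ * (c.2.2 * c'.2.2⁻¹) with hk
    have hkG : (k : G) = (c.2.1 : G) * (c'.2.1 : G)⁻¹ * ((c.2.2 : G) * (c'.2.2 : G)⁻¹) := by simp [hk]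
    have hw' : (c.1 : G) * r * ((c'.1 : G) * r')⁻¹ * (k : G) = 1 := by
      rw [hkG]; simpa only [lift, cellWord, mul_assoc] using hw
    have hX : (c.1 : G) * r * ((c'.1 : G) * r')⁻¹ = (k : G)⁻¹ := eq_inv_of_mul_eq_one_left hw'
    have hr : r = (c.1 : G)⁻¹ * (k : G)⁻¹ * (c'.1 : G) * r' := by
      have : r = ((c.1 : G)⁻¹) * ((c.1 : G) * r * ((c'.1 : G) * r')⁻¹) * ((c'.1 : G) * r') := by group
      rw [hX] at this; simpa only [mul_assoc] using this
    have hmem : (c.1 : G)⁻¹ * (k : G)⁻¹ * (c'.1 : G) ∈ H :=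
      H.mul_mem (H.mul_mem (H.inv_mem c.1.2) (H.inv_mem k.2)) c'.1.2
    obtain ⟨-, hrr⟩ := uniq 1 ((c.1 : G)⁻¹ * (k : G)⁻¹ * (c'.1 : G)) r r' H.one_mem hmem hcr.2 hcr'.2
      (by rw [one_mul]; exact hr)
    subst hrr
    -- now the word is `H`'s own cell word
    have hcc : c ≠ c' := by
      rintro rfl; exact hne rfl
    have hH : ((cellWord c c' : ↥H) : G) = 1 := by
      rw [cellWord_subtype]
      have h1 : (c.1 : G) * r * ((c'.1 : G) * r)⁻¹ = (c.1 : G) * (c'.1 : G)⁻¹ := by group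
      have := hw; simp only [lift, cellWord] at this ⊢; rw [h1] at this; exact this
    exact hind c hcr.1 c' hcr'.1 hcc (Subtype.ext (by simpa using hH))
  have key := hG (Y.map emb) (W.map emb) (by rw [Finset.card_map, hY]) (by rw [Finset.card_map, hW]) J hJbox hJind
  rw [hJcard] at key
  have hGcard : Fintype.card G = Fintype.card ↥H * H.index := by
    rw [Fintype.card_eq_nat_card, Fintype.card_eq_nat_card]; exact (H.card_mul_index).symm
  rw [hGcard] at key
  have hidx : 0 < H.index := Nat.pos_of_ne_zero H.index_ne_zero_of_finite
  nlinarith [key, hidx]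

omit [Fintype G] [DecidableEq G] in
/-- The cell word is mapped by a group homomorphism componentwise. [folklore] -/
theorem map_cellWord {K : Type*} [Group K] [DecidableEq K] (f : G →* K) (P P' : G × G × G) :
    f (cellWord P P') = cellWord (f P.1, (f P.2.1, f P.2.2)) (f P'.1, (f P'.2.1, f P'.2.2)) := by
  simp [cellWord, map_mul, map_inv]

/-- **C9 (a), quotient half, in the kernel.** Box-usefulness passes from a finite group to each of its quotients (lift every
cell `(q, ȳ, w̄)` to all `|N|` cells `(x, y, w)` over `q` along a section). [folklore] -/
theorem BoxUseful.quotient (hG : BoxUseful G) (N : Subgroup G) [N.Normal] [Fintype (G ⧸ N)] [DecidableEq (G ⧸ N)] :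
    BoxUseful (G ⧸ N) := by
  classical
  intro Y W hY hW I hI hind
  haveI : Fintype ↥N := Fintype.ofFinite _
  set φ : G →* G ⧸ N := QuotientGroup.mk' N with hφdef
  have hφ : Function.Surjective φ := QuotientGroup.mk'_surjective N
  set σ : G ⧸ N → G := Function.surjInv hφ with hσdef
  have hσ : ∀ q, φ (σ q) = q := Function.surjInv_eq hφ
  have σinj : Function.Injective σ := Function.injective_surjInv hφ
  have hφN : ∀ n : ↥N, φ (n : G) = 1 := fun n => by
    rw [hφdef, QuotientGroup.mk'_apply, QuotientGroup.eq_one_iff]; exact n.2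
  have hφlift : ∀ (q : G ⧸ N) (n : ↥N), φ (σ q * (n : G)) = q := fun q n => by rw [map_mul, hσ, hφN, mul_one]
  let emb : (G ⧸ N) ↪ G := ⟨σ, σinj⟩
  let lift : ((G ⧸ N) × (G ⧸ N) × (G ⧸ N)) × ↥N → G × G × G := fun p => (σ p.1.1 * (p.2 : G), (σ p.1.2.1, σ p.1.2.2))
  have lift_inj : Set.InjOn lift ↑(I ×ˢ (Finset.univ : Finset ↥N)) := by
    rintro ⟨c, n⟩ - ⟨c', n'⟩ - heq
    simp only [lift, Prod.mk.injEq] at heq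
    obtain ⟨h1, h2, h3⟩ := heq
    have hq : c.1 = c'.1 := by
      have := congrArg φ h1; rwa [hφlift, hφlift] at this
    have hn : n = n' := by
      rw [hq] at h1; exact Subtype.ext (mul_left_cancel h1)
    exact Prod.ext (Prod.ext hq (Prod.ext (σinj h2) (σinj h3))) hn
  set J : Finset (G × G × G) := (I ×ˢ (Finset.univ : Finset ↥N)).image lift with hJ
  have hJcard : J.card = I.card * Fintype.card ↥N := by
    rw [hJ, Finset.card_image_of_injOn lift_inj, Finset.card_product, Finset.card_univ]
  have hJbox : J ⊆ univ ×ˢ (Y.map emb ×ˢ W.map emb) := by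
    intro P hP
    obtain ⟨⟨c, n⟩, hcn, rfl⟩ := Finset.mem_image.1 hP
    rw [Finset.mem_product] at hcn
    have hc := hI hcn.1
    simp only [Finset.mem_product, Finset.mem_univ, true_and] at hc
    simp only [lift, Finset.mem_product, Finset.mem_univ, true_and, Finset.mem_map, Function.Embedding.coeFn_mk, emb]
    exact ⟨⟨c.2.1, hc.1, rfl⟩, ⟨c.2.2, hc.2, rfl⟩⟩
  have hJind : ∀ P ∈ J, ∀ P' ∈ J, P ≠ P' → cellWord P P' ≠ 1 := by
    intro P hP P' hP' hne hw
    obtain ⟨⟨c, n⟩, hcn, rfl⟩ := Finset.mem_image.1 hP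
    obtain ⟨⟨c', n'⟩, hcn', rfl⟩ := Finset.mem_image.1 hP'
    rw [Finset.mem_product] at hcn hcn'
    -- project the word to the quotient: it is the word of `c, c'`
    have hproj : cellWord c c' = 1 := by
      have := congrArg φ hw
      rw [map_cellWord, map_one] at this
      simpa only [lift, hφlift, hσ] using this
    by_cases hcc : c = c'
    · subst hcc
      have hnn : n ≠ n' := by rintro rfl; exact hne rfl
      apply hnn
      -- the word is `σq n (σq n')⁻¹`
      have : σ c.1 * (n : G) * (σ c.1 * (n' : G))⁻¹ = 1 := by simpa [lift, cellWord] using hw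
      have h2 : (n : G) = (n' : G) := by
        have := mul_inv_eq_one.1 this
        exact mul_left_cancel this
      exact Subtype.ext h2
    · exact hind c hcn.1 c' hcn'.1 hcc hproj
  have key := hG (Y.map emb) (W.map emb) (by rw [Finset.card_map, hY]) (by rw [Finset.card_map, hW]) J hJbox hJind
  rw [hJcard] at key
  have hGcard : Fintype.card G = Fintype.card (G ⧸ N) * Fintype.card ↥N := by
    rw [Fintype.card_eq_nat_card, Fintype.card_eq_nat_card, Fintype.card_eq_nat_card]
    exact Subgroup.card_eq_card_quotient_mul_card_subgroup N
  rw [hGcard] at key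
  have hN : 0 < Fintype.card ↥N := Fintype.card_pos
  nlinarith [key, hN]

end Summit.MatrixMultiplication.OmegaCensus
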